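import Summits.ValiantsHypothesis.ValiantsHypothesis.Theorems.LacunarySymmetroidMatrixDescartesFiniteSectorArrowDesign
import Summits.ValiantsHypothesis.ValiantsHypothesis.Theorems.LacunarySymmetroidMatrixDescartesFiniteSectorArrowEstimates
import Summits.ValiantsHypothesis.ValiantsHypothesis.Theorems.LacunarySymmetroidMatrixDescartesFiniteSectorRealisable
import Summits.ValiantsHypothesis.ValiantsHypothesis.Theorems.LacunarySymmetroidMatrixDescartesFiniteSectorEtaTwoSix

/-!
# `MatrixDescartes` — line «finite» / «stamp»: THE `(0,1,3)` LADDER IS REALISABLE AT EVERY RUNG —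
# `FullyRealisable m ![0,1,3] (3m − 2)` for EVERY `m ≥ 1`; hence `ν(m,3) ≥ 3m − 2` and `η(m,3) ≥ 6m − 4` for all `m`

HONEST FRAMING.  Object-search cell `pub-symmetroid`, seat val-sym-eng-3 g11 (census/instrument ENGINE #3 of D-0148 (b)).
HELPER of the crux item `stmt-ValiantsHypothesis-18050`
(`Summit.ValiantsHypothesis.ValiantsHypothesis.Theses.LacunarySymmetroid.MatrixDescartes`, asymptotic in `K`) with NO closure
claim.  Instrument/structure tier: an ALL-`m` REALISABILITY (lower-side) statement in the `K = 3` stamp column,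

* `fullyRealisable_ladder013 (m) (hm : 1 ≤ m) : FullyRealisable m ![0, 1, 3] (3 * m - 2)` —

for every size `m` there is a real symmetric half-pencil `S₀ + t S₁ + t³ S₂` whose determinant has degree exactly `3m − 2` and
`3m − 2` distinct positive zeros.  On the support `(0,1,d)` a full-positive-rooted determinant has degree `≤ d(m+3−d) − 2` (two
denominations `{1,d}`, `m` stamps — the mechanism of `stampLawAt_three_of_stamps`); at `d = 3` this is `3m − 2`, so EVERY rung of
the `(0,1,3)` ladder of the cell's located programme (val-sym-eng-3 g6–g9, memos `LADDER-017/018`) is realisable, for all `m` at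
once.  `m = 3, 4`: the column's top values `ν(3,3) = 7`, `ν(4,3) = 10` (other witnesses: `…FiniteSectorRealisable`); `m ≥ 5`: below
the top rung `n(m,2) = ⌊(m²+6m+1)/4⌋` (`stampLawAt_K_three`).  Read as stamp-table rows: `ν(m,3) ≥ 3m − 2` for every `m`
(`not_stampLawAt_ladder013`; the previous all-`m` kernel bound was `2m`, `not_stampLawAt_rankOneRung`) and, doubled by T2 of line
«finite» (`not_hypRootLawAt_of_fullyRealisable`), `η(m,3) ≥ 6m − 4` (`not_hypRootLawAt_ladder013`).
Nothing here bears on the crux (asymptotic in `K`) or on `VP ≠ VNP`.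

THE WITNESS (`…FiniteSectorArrowDesign`, estimates `…FiniteSectorArrowEstimates`): the ARROW design with `M = m − 1` leaves,
hub last, base `B = 4(M+2)`:
`S₀ + tS₁ + t³S₂ = [[diag((-1)^{k+1}(1 + t³/B^{24(k+1)})), (B^{-(k+1)}(1 − t/B^{8k+7}))_k], [·ᵀ, (-1)^M B^{-2M-2}(1 − t/B^{8M+7})]]`,
`det = (∏ leaf diagonal) · h(t)`, `h = c − ∑_k (-1)^{k+1} G_k` (Schur).  The leaf diagonal never vanishes on `t ≥ 0`, so the sign
of the determinant is (a constant times) the sign of `h`, and along `u = log_B t` the leaves dominate `h` ONE AFTER THE OTHER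
(§4: `arrowSign_window`, `arrowSign_dip`, `arrowSign_dipLast`, `arrowSign_post`, `arrowSign_last`): leaf `k` (0-based) is read
at `t = B^{8k+6}` (sign `(-1)^k`), at its dip `t = B^{8k+7}` where `b_k = 0` and the next leaf — for the last leaf, the corner —
speaks (sign `(-1)^{k+1}`), and at `t = B^{8k+8}` (sign `(-1)^k`); then the hub at `B^{8M+6}` (`(-1)^M`) and `B^{8M+8}`
(`(-1)^{M+1}`): `3M + 2 = 3m − 1` points with the signs `(-1)^i`, every non-dominant term being `≤ (reference)/B` by per-term
bounds (`2(M+1) < B`), so `fullyRealisable_of_certificate` applies with the polynomial of `natDegree ≤ 3M + 1`.  Exact cross-check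
`m = 2..8` (rational arithmetic, Sturm count `= 3m − 2`): `HOME/val-sym-eng-3/g11/tools/arrow_check.py`.  [folklore] IVT bookkeeping.
-/

-- `Summit.ValiantsHypothesis.ValiantsHypothesis.…` repeats a component by the D-0017 layout
-- (single-conjunct summit), which the `dupNamespace` linter flags; the name is mandated.
set_option linter.dupNamespace false

namespace Summit.ValiantsHypothesis.ValiantsHypothesis.Theorems.LacunarySymmetroidMatrixDescartes.FiniteSector

open scoped BigOperators Matrix
open Polynomial Finset Matrix
open Summit.ValiantsHypothesis.ValiantsHypothesis.Theorems.SymmetroidDescartes (eval_det_pencil)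

/-! ## §4 The sign certificate of the Schur complement `h(t) = c(t) - ∑_k (-1)^{k+1} G_k(t)` -/

/-- The leaf term `G_j(t) = b_j(t)² / (1 + t³/B^{24(j+1)})` (local notation, no definition). -/
local notation3 (prettyPrint := false) "G[" B ", " j "](" t ")" =>
  ((1 / (B : ℝ) ^ ((j : ℕ) + 1) - (t : ℝ) / (B : ℝ) ^ (9 * (j : ℕ) + 8)) ^ 2
    / (1 + (t : ℝ) ^ 3 / (B : ℝ) ^ (24 * ((j : ℕ) + 1))))

/-- The corner entry `c(t)` (local notation, no definition). -/
local notation3 (prettyPrint := false) "cor[" B ", " M "](" t ")" =>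
  ((-1 : ℝ) ^ (M : ℕ) / (B : ℝ) ^ (2 * (M : ℕ) + 2) + -(-1 : ℝ) ^ (M : ℕ) / (B : ℝ) ^ (10 * (M : ℕ) + 9) * (t : ℝ))

/-- **Window readings.**  For a leaf `k` and `B^{8k+6} ≤ t ≤ B^{8k+8}` with `G_k(t) ≥ ½/B^{2(k+1)}` (pre-dip and peak
points), `(-1)^k h(t) > 0`: the `k`-th leaf dominates the corner and all other leaves. [folklore] -/
theorem arrowSign_window {M : ℕ} {B : ℝ} (hB : 8 ≤ B) (hMB : 2 * ((M : ℝ) + 1) < B) (k : Fin M) {t : ℝ}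
    (ht1 : B ^ (8 * (k : ℕ) + 6) ≤ t) (ht2 : t ≤ B ^ (8 * (k : ℕ) + 8))
    (hr : 1 / B ^ (2 * ((k : ℕ) + 1)) / 2 ≤ G[B, k](t)) :
    0 < (-1 : ℝ) ^ (k : ℕ) * (cor[B, M](t) - ∑ j : Fin M, (-1 : ℝ) ^ ((j : ℕ) + 1) * G[B, j](t)) := by
  have hB1 : 1 ≤ B := by linarith
  have hB0 : 0 < B := by linarith
  have hkM : (k : ℕ) < M := k.isLt
  have ht0 : 0 ≤ t := le_trans (by positivity) ht1
  have hsplit := (Finset.add_sum_erase univ (fun j : Fin M => (-1 : ℝ) ^ ((j : ℕ) + 1) * G[B, j](t)) (mem_univ k)).symm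
  have hkk : (-1 : ℝ) ^ (k : ℕ) * (-1) ^ ((k : ℕ) + 1) = -1 := by
    rw [← pow_add, show (k : ℕ) + ((k : ℕ) + 1) = 2 * (k : ℕ) + 1 by ring, pow_succ, pow_mul]; norm_num
  have hid : (-1 : ℝ) ^ (k : ℕ) * (cor[B, M](t) - ∑ j : Fin M, (-1 : ℝ) ^ ((j : ℕ) + 1) * G[B, j](t))
      = G[B, k](t) + (-1 : ℝ) ^ (k : ℕ) * cor[B, M](t)
        + ∑ j ∈ univ.erase k, -((-1 : ℝ) ^ (k : ℕ) * ((-1 : ℝ) ^ ((j : ℕ) + 1) * G[B, j](t))) := by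
    rw [hsplit, Finset.sum_neg_distrib, ← Finset.mul_sum]
    linear_combination (-(G[B, k](t))) * hkk
  rw [hid]
  have hRB : 1 / B ^ (2 * ((k : ℕ) + 1)) / B = 1 / B ^ (2 * (k : ℕ) + 3) := by
    rw [div_div, ← pow_succ]; ring_nf
  refine pos_of_dominant_term (univ.erase k) _ (by positivity) hB0 hMB hr ?_ ?_ ?_
  · rw [hRB, abs_mul, abs_pow, abs_neg, abs_one, one_pow, one_mul]
    refine (arrowCorner_abs_le hB0 M ht0 (ht2.trans (pow_le_pow_right₀ hB1 (by omega)))).trans ?_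
    exact one_div_pow_le_one_div_pow_of_le hB1 (by omega)
  · intro j hj
    rw [hRB, abs_arrowLeaf_signed hB0 ht0]
    rcases lt_or_gt_of_ne (Fin.val_injective.ne (Finset.mem_erase.1 hj).1) with hjk | hjk
    · exact arrowLeaf_below_le hB1 j ht1 (by omega) (by omega)
    · exact arrowLeaf_above_le hB1 j ht0 (ht2.trans (pow_le_pow_right₀ hB1 (by omega))) (by omega)
  · rw [Finset.card_erase_of_mem (mem_univ k), card_univ, Fintype.card_fin]; omega

/-- **Dip reading inside the leaf range.**  At `t = B^{8k+7}` with `k + 1 < M`, the `k`-th leaf term vanishes and the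
NEXT leaf dominates: `(-1)^{k+1} h(t) > 0`. [folklore] -/
theorem arrowSign_dip {M : ℕ} {B : ℝ} (hB : 8 ≤ B) (hMB : 2 * ((M : ℝ) + 1) < B) (k : Fin M) (hk : (k : ℕ) + 1 < M) :
    0 < (-1 : ℝ) ^ ((k : ℕ) + 1) *
      (cor[B, M](B ^ (8 * (k : ℕ) + 7)) - ∑ j : Fin M, (-1 : ℝ) ^ ((j : ℕ) + 1) * G[B, j](B ^ (8 * (k : ℕ) + 7))) := by
  have hB1 : 1 ≤ B := by linarith
  have hB0 : 0 < B := by linarith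
  set t : ℝ := B ^ (8 * (k : ℕ) + 7) with htdef
  have ht0 : 0 ≤ t := by positivity
  set k' : Fin M := ⟨(k : ℕ) + 1, hk⟩ with hk'
  have hk'v : (k' : ℕ) = (k : ℕ) + 1 := rfl
  have hsplit := (Finset.add_sum_erase univ (fun j : Fin M => (-1 : ℝ) ^ ((j : ℕ) + 1) * G[B, j](t)) (mem_univ k')).symm
  have hkk : (-1 : ℝ) ^ ((k : ℕ) + 1) * (-1) ^ ((k' : ℕ) + 1) = -1 := by
    rw [hk'v, ← pow_add, show (k : ℕ) + 1 + ((k : ℕ) + 1 + 1) = 2 * ((k : ℕ) + 1) + 1 by ring, pow_succ, pow_mul]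
    norm_num
  have hid : (-1 : ℝ) ^ ((k : ℕ) + 1) * (cor[B, M](t) - ∑ j : Fin M, (-1 : ℝ) ^ ((j : ℕ) + 1) * G[B, j](t))
      = G[B, k'](t) + (-1 : ℝ) ^ ((k : ℕ) + 1) * cor[B, M](t)
        + ∑ j ∈ univ.erase k', -((-1 : ℝ) ^ ((k : ℕ) + 1) * ((-1 : ℝ) ^ ((j : ℕ) + 1) * G[B, j](t))) := by
    rw [hsplit, Finset.sum_neg_distrib, ← Finset.mul_sum]
    linear_combination (-(G[B, k'](t))) * hkk
  rw [hid]
  have hr : 1 / B ^ (2 * ((k : ℕ) + 2)) / 2 ≤ G[B, k'](t) := by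
    rw [hk'v, htdef]
    exact arrowLeaf_ref_dip hB k
  have hRB : 1 / B ^ (2 * ((k : ℕ) + 2)) / B = 1 / B ^ (2 * (k : ℕ) + 5) := by
    rw [div_div, ← pow_succ]; ring_nf
  refine pos_of_dominant_term (univ.erase k') _ (by positivity) hB0 hMB hr ?_ ?_ ?_
  · rw [hRB, abs_mul, abs_pow, abs_neg, abs_one, one_pow, one_mul]
    refine (arrowCorner_abs_le hB0 M ht0 (pow_le_pow_right₀ hB1 (by omega))).trans ?_
    exact one_div_pow_le_one_div_pow_of_le hB1 (by omega)
  · intro j hj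
    rw [hRB, abs_arrowLeaf_signed hB0 ht0]
    have hne : (j : ℕ) ≠ (k : ℕ) + 1 := fun h => (Finset.mem_erase.1 hj).1 (Fin.ext (h.trans hk'v.symm))
    rcases Nat.lt_trichotomy (j : ℕ) (k : ℕ) with hjk | hjk | hjk
    · exact arrowLeaf_below_le hB1 j le_rfl (by omega) (by omega)
    · rw [hjk, htdef, arrowLeaf_dip_zero hB0]; positivity
    · exact arrowLeaf_above_le hB1 j ht0 (pow_le_pow_right₀ hB1 (by omega)) (by omega)
  · rw [Finset.card_erase_of_mem (mem_univ k'), card_univ, Fintype.card_fin]; omega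

/-- **Dip reading at the last leaf.**  At `t = B^{8k+7}` with `k + 1 = M`, the `k`-th leaf term vanishes and the
CORNER speaks: `(-1)^{k+1} h(t) > 0`. [folklore] -/
theorem arrowSign_dipLast {M : ℕ} {B : ℝ} (hB : 8 ≤ B) (hMB : 2 * ((M : ℝ) + 1) < B) (k : Fin M) (hk : (k : ℕ) + 1 = M) :
    0 < (-1 : ℝ) ^ ((k : ℕ) + 1) *
      (cor[B, M](B ^ (8 * (k : ℕ) + 7)) - ∑ j : Fin M, (-1 : ℝ) ^ ((j : ℕ) + 1) * G[B, j](B ^ (8 * (k : ℕ) + 7))) := by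
  have hB1 : 1 ≤ B := by linarith
  have hB0 : 0 < B := by linarith
  have hB2 : 2 ≤ B := by linarith
  set t : ℝ := B ^ (8 * (k : ℕ) + 7) with htdef
  have ht0 : 0 ≤ t := by positivity
  have hid : (-1 : ℝ) ^ ((k : ℕ) + 1) * (cor[B, M](t) - ∑ j : Fin M, (-1 : ℝ) ^ ((j : ℕ) + 1) * G[B, j](t))
      = (-1 : ℝ) ^ ((k : ℕ) + 1) * cor[B, M](t) + 0
        + ∑ j : Fin M, -((-1 : ℝ) ^ ((k : ℕ) + 1) * ((-1 : ℝ) ^ ((j : ℕ) + 1) * G[B, j](t))) := by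
    rw [Finset.sum_neg_distrib, ← Finset.mul_sum]; ring
  rw [hid]
  have hr : 1 / B ^ (2 * M + 2) / 2 ≤ (-1 : ℝ) ^ ((k : ℕ) + 1) * cor[B, M](t) := by
    rw [hk, htdef]
    exact (arrowCorner_ref hB2 M).1 k hk
  have hRB : 1 / B ^ (2 * M + 2) / B = 1 / B ^ (2 * M + 3) := by rw [div_div, ← pow_succ]
  refine pos_of_dominant_term univ _ (by positivity) hB0 hMB hr ?_ ?_ ?_
  · rw [abs_zero]; positivity
  · intro j _
    rw [hRB, abs_arrowLeaf_signed hB0 ht0]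
    rcases lt_or_ge (j : ℕ) (k : ℕ) with hjk | hjk
    · exact arrowLeaf_below_le hB1 j le_rfl (by omega) (by omega)
    · have hjk' : (j : ℕ) = k := by have := j.isLt; omega
      rw [hjk', htdef, arrowLeaf_dip_zero hB0]; positivity
  · rw [card_univ, Fintype.card_fin]

/-- **Hub reading after the last leaf.**  At `t = B^{8M+6}` the corner dominates every (decayed) leaf:
`(-1)^M h(t) > 0`. [folklore] -/
theorem arrowSign_post (M : ℕ) {B : ℝ} (hB : 8 ≤ B) (hMB : 2 * ((M : ℝ) + 1) < B) :
    0 < (-1 : ℝ) ^ M *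
      (cor[B, M](B ^ (8 * M + 6)) - ∑ j : Fin M, (-1 : ℝ) ^ ((j : ℕ) + 1) * G[B, j](B ^ (8 * M + 6))) := by
  have hB1 : 1 ≤ B := by linarith
  have hB0 : 0 < B := by linarith
  have hB2 : 2 ≤ B := by linarith
  set t : ℝ := B ^ (8 * M + 6) with htdef
  have ht0 : 0 ≤ t := by positivity
  have hid : (-1 : ℝ) ^ M * (cor[B, M](t) - ∑ j : Fin M, (-1 : ℝ) ^ ((j : ℕ) + 1) * G[B, j](t))
      = (-1 : ℝ) ^ M * cor[B, M](t) + 0 + ∑ j : Fin M, -((-1 : ℝ) ^ M * ((-1 : ℝ) ^ ((j : ℕ) + 1) * G[B, j](t))) := by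
    rw [Finset.sum_neg_distrib, ← Finset.mul_sum]; ring
  rw [hid]
  have hr : 1 / B ^ (2 * M + 2) / 2 ≤ (-1 : ℝ) ^ M * cor[B, M](t) := by
    rw [htdef]; exact (arrowCorner_ref hB2 M).2.1
  have hRB : 1 / B ^ (2 * M + 2) / B = 1 / B ^ (2 * M + 3) := by rw [div_div, ← pow_succ]
  refine pos_of_dominant_term univ _ (by positivity) hB0 hMB hr ?_ ?_ ?_
  · rw [abs_zero]; positivity
  · intro j _
    rw [hRB, abs_arrowLeaf_signed hB0 ht0]
    have := j.isLt
    exact arrowLeaf_below_le hB1 j le_rfl (by omega) (by omega)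
  · rw [card_univ, Fintype.card_fin]

/-- **Last hub reading.**  At `t = B^{8M+8}` the corner has changed sign and still dominates:
`(-1)^{M+1} h(t) > 0`. [folklore] -/
theorem arrowSign_last (M : ℕ) {B : ℝ} (hB : 8 ≤ B) (hMB : 2 * ((M : ℝ) + 1) < B) :
    0 < (-1 : ℝ) ^ (M + 1) *
      (cor[B, M](B ^ (8 * M + 8)) - ∑ j : Fin M, (-1 : ℝ) ^ ((j : ℕ) + 1) * G[B, j](B ^ (8 * M + 8))) := by
  have hB1 : 1 ≤ B := by linarith
  have hB0 : 0 < B := by linarith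
  have hB2 : 2 ≤ B := by linarith
  set t : ℝ := B ^ (8 * M + 8) with htdef
  have ht0 : 0 ≤ t := by positivity
  have hid : (-1 : ℝ) ^ (M + 1) * (cor[B, M](t) - ∑ j : Fin M, (-1 : ℝ) ^ ((j : ℕ) + 1) * G[B, j](t))
      = (-1 : ℝ) ^ (M + 1) * cor[B, M](t) + 0
        + ∑ j : Fin M, -((-1 : ℝ) ^ (M + 1) * ((-1 : ℝ) ^ ((j : ℕ) + 1) * G[B, j](t))) := by
    rw [Finset.sum_neg_distrib, ← Finset.mul_sum]; ring
  rw [hid]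
  have hr : 1 / B ^ (2 * M + 2) / 2 ≤ (-1 : ℝ) ^ (M + 1) * cor[B, M](t) := by
    rw [htdef]; exact (arrowCorner_ref hB2 M).2.2
  have hRB : 1 / B ^ (2 * M + 2) / B = 1 / B ^ (2 * M + 3) := by rw [div_div, ← pow_succ]
  refine pos_of_dominant_term univ _ (by positivity) hB0 hMB hr ?_ ?_ ?_
  · rw [abs_zero]; positivity
  · intro j _
    rw [hRB, abs_arrowLeaf_signed hB0 ht0]
    have := j.isLt
    exact arrowLeaf_below_le hB1 j le_rfl (by omega) (by omega)
  · rw [card_univ, Fintype.card_fin]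


/-! ## §5 Assembly: the `(0,1,3)` ladder is realisable at every rung -/

/-- **Rung `M + 1` of the `(0,1,3)` ladder: `FullyRealisable (M+1) ![0,1,3] (3M+1)`** — the arrow design with `M`
leaves and base `B = 4(M+2)`, certified at the `3M + 2` points `B^{8k+6}, B^{8k+7}, B^{8k+8}` (`k < M`),
`B^{8M+6}`, `B^{8M+8}` where `(-1)^i h > 0`. [folklore] -/
theorem fullyRealisable_ladder013_succ (M : ℕ) :
    FullyRealisable (M + 1) (![0, 1, 3] : Fin 3 → ℕ) (3 * M + 1) := by
  classical
  -- the base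
  set B : ℝ := 4 * ((M : ℝ) + 2) with hBdef
  have hM0 : (0 : ℝ) ≤ M := Nat.cast_nonneg M
  have hB8 : 8 ≤ B := by rw [hBdef]; linarith
  have hMB : 2 * ((M : ℝ) + 1) < B := by rw [hBdef]; linarith
  obtain ⟨hB0, hB1, hB2⟩ : 0 < B ∧ 1 < B ∧ 2 ≤ B := ⟨by linarith, by linarith, by linarith⟩
  -- the letters
  set S : Fin 3 → Matrix (Fin (M + 1)) (Fin (M + 1)) ℝ :=
    ![Matrix.reindex finSumFinEquiv finSumFinEquiv
        (Matrix.fromBlocks (diagonal fun k : Fin M => (-1 : ℝ) ^ ((k : ℕ) + 1))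
          (Matrix.of fun (k : Fin M) (_ : Fin 1) => 1 / B ^ ((k : ℕ) + 1))
          (Matrix.of fun (_ : Fin 1) (k : Fin M) => 1 / B ^ ((k : ℕ) + 1))
          (Matrix.of fun (_ _ : Fin 1) => (-1 : ℝ) ^ M / B ^ (2 * M + 2))),
      Matrix.reindex finSumFinEquiv finSumFinEquiv
        (Matrix.fromBlocks (diagonal fun _ : Fin M => (0 : ℝ))
          (Matrix.of fun (k : Fin M) (_ : Fin 1) => -(1 / B ^ (9 * (k : ℕ) + 8)))
          (Matrix.of fun (_ : Fin 1) (k : Fin M) => -(1 / B ^ (9 * (k : ℕ) + 8)))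
          (Matrix.of fun (_ _ : Fin 1) => -(-1 : ℝ) ^ M / B ^ (10 * M + 9))),
      Matrix.reindex finSumFinEquiv finSumFinEquiv
        (Matrix.fromBlocks (diagonal fun k : Fin M => (-1 : ℝ) ^ ((k : ℕ) + 1) / B ^ (24 * ((k : ℕ) + 1)))
          (Matrix.of fun (_ : Fin M) (_ : Fin 1) => (0 : ℝ))
          (Matrix.of fun (_ : Fin 1) (_ : Fin M) => (0 : ℝ))
          (Matrix.of fun (_ _ : Fin 1) => (0 : ℝ)))] with hSdef
  -- the determinant polynomial
  set p : ℝ[X] :=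
    (C ((-1 : ℝ) ^ M / B ^ (2 * M + 2)) + C (-(-1 : ℝ) ^ M / B ^ (10 * M + 9)) * X) *
        ∏ k : Fin M, (C ((-1 : ℝ) ^ ((k : ℕ) + 1)) + C ((-1 : ℝ) ^ ((k : ℕ) + 1) / B ^ (24 * ((k : ℕ) + 1))) * X ^ 3)
      - ∑ k : Fin M, (C (1 / B ^ ((k : ℕ) + 1)) + C (-(1 / B ^ (9 * (k : ℕ) + 8))) * X) ^ 2 *
          ∏ j ∈ univ.erase k, (C ((-1 : ℝ) ^ ((j : ℕ) + 1)) + C ((-1 : ℝ) ^ ((j : ℕ) + 1) / B ^ (24 * ((j : ℕ) + 1))) * X ^ 3)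
    with hpdef
  -- the determinant at `t ≥ 0`: (product of the leaf diagonal) × (Schur complement `h(t)`)
  have hdet : ∀ t : ℝ, 0 ≤ t → (∑ l, t ^ (![0, 1, 3] : Fin 3 → ℕ) l • S l).det
      = (∏ k : Fin M, ((-1 : ℝ) ^ ((k : ℕ) + 1) + (-1 : ℝ) ^ ((k : ℕ) + 1) / B ^ (24 * ((k : ℕ) + 1)) * t ^ 3)) *
          (cor[B, M](t) - ∑ j : Fin M, (-1 : ℝ) ^ ((j : ℕ) + 1) * G[B, j](t)) := by
    intro t ht
    rw [hSdef, arrowPencil_eval, det_arrowPencil M hB0 ht]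
  have hevalp : ∀ t : ℝ, 0 ≤ t → (∑ l, t ^ (![0, 1, 3] : Fin 3 → ℕ) l • S l).det = p.eval t := by
    intro t ht
    rw [hdet t ht, arrowSchur_expand M hB0 ht, hpdef, eval_arrowPoly]
  -- hence a polynomial identity, valid at every real `t`
  have hpoly : (pencil (![0, 1, 3] : Fin 3 → ℕ) S).det = p := by
    apply Polynomial.eq_of_infinite_eval_eq
    refine Set.Infinite.mono (fun t (ht : t ∈ Set.Ioi (0 : ℝ)) => ?_) (Set.Ioi_infinite (0 : ℝ))
    show ((pencil (![0, 1, 3] : Fin 3 → ℕ) S).det).eval t = p.eval t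
    rw [eval_det_pencil, hevalp t (le_of_lt ht)]
  have heval : ∀ t : ℝ, (∑ l, t ^ (![0, 1, 3] : Fin 3 → ℕ) l • S l).det = p.eval t := by
    intro t
    rw [← eval_det_pencil S (![0, 1, 3] : Fin 3 → ℕ) t]
    exact congrArg (Polynomial.eval t) hpoly
  have hdeg : p.natDegree ≤ 3 * M + 1 := by rw [hpdef]; exact natDegree_arrowPoly_le M B
  -- the certificate points `B^{e_i}`
  set e : Fin (3 * M + 2) → ℕ := fun i =>
    8 * ((i : ℕ) / 3) + 6 + (i : ℕ) % 3 + (if (i : ℕ) = 3 * M + 1 then 1 else 0) with hedef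
  set τ : Fin (3 * M + 2) → ℝ := fun i => B ^ e i with hτdef
  have hτpos : ∀ i, 0 < τ i := fun i => by rw [hτdef]; positivity
  have hτmono : StrictMono τ := by
    refine Fin.strictMono_iff_lt_succ.2 fun i => ?_
    rw [hτdef]
    refine pow_lt_pow_right₀ hB1 ?_
    have hi : (i : ℕ) < 3 * M + 1 := i.isLt
    simp only [hedef, Fin.val_castSucc, Fin.val_succ]
    split_ifs with h1 h2 h2 <;> omega
  -- the signs `(-1)^i h(τ_i) > 0`
  have hsign : ∀ i : Fin (3 * M + 2),
      0 < (-1 : ℝ) ^ (i : ℕ) * (cor[B, M](τ i) - ∑ j : Fin M, (-1 : ℝ) ^ ((j : ℕ) + 1) * G[B, j](τ i)) := by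
    intro i
    have hi : (i : ℕ) < 3 * M + 2 := i.isLt
    obtain ⟨q, c, hqc, hc3⟩ : ∃ q c : ℕ, (i : ℕ) = 3 * q + c ∧ c < 3 :=
      ⟨(i : ℕ) / 3, (i : ℕ) % 3, by omega, Nat.mod_lt _ (by norm_num)⟩
    have hq' : (i : ℕ) / 3 = q := by omega
    have hc' : (i : ℕ) % 3 = c := by omega
    have hτi : τ i = B ^ (8 * q + 6 + c + if (i : ℕ) = 3 * M + 1 then 1 else 0) := by
      show B ^ (8 * ((i : ℕ) / 3) + 6 + (i : ℕ) % 3 + if (i : ℕ) = 3 * M + 1 then 1 else 0) = _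
      rw [hq', hc']
    by_cases hq : q < M
    · -- readings of leaf `q`
      have hne : (i : ℕ) ≠ 3 * M + 1 := by omega
      rw [if_neg hne, add_zero] at hτi
      set k : Fin M := ⟨q, hq⟩ with hk
      have hkv : (k : ℕ) = q := rfl
      interval_cases c
      · -- pre-dip point `B^{8q+6}`
        have hpar : (-1 : ℝ) ^ (i : ℕ) = (-1) ^ (k : ℕ) := by
          rw [hqc, hkv, show 3 * q + 0 = 2 * q + q by ring, pow_add, pow_mul]; norm_num
        rw [hpar, hτi, add_zero, ← hkv]
        exact arrowSign_window hB8 hMB k le_rfl (pow_le_pow_right₀ hB1.le (by omega)) (arrowLeaf_ref_pre hB8 k)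
      · -- dip point `B^{8q+7}`
        have hpar : (-1 : ℝ) ^ (i : ℕ) = (-1) ^ ((k : ℕ) + 1) := by
          rw [hqc, hkv, show 3 * q + 1 = 2 * q + (q + 1) by ring, pow_add, pow_mul]; norm_num
        rw [hpar, hτi, show 8 * q + 6 + 1 = 8 * (k : ℕ) + 7 by rw [hkv]]
        by_cases hq1 : (k : ℕ) + 1 < M
        · exact arrowSign_dip hB8 hMB k hq1
        · exact arrowSign_dipLast hB8 hMB k (by omega)
      · -- peak point `B^{8q+8}`
        have hpar : (-1 : ℝ) ^ (i : ℕ) = (-1) ^ (k : ℕ) := by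
          rw [hqc, hkv, show 3 * q + 2 = 2 * (q + 1) + q by ring, pow_add, pow_mul]; norm_num
        rw [hpar, hτi, show 8 * q + 6 + 2 = 8 * (k : ℕ) + 8 by rw [hkv]]
        exact arrowSign_window hB8 hMB k (pow_le_pow_right₀ hB1.le (by omega)) le_rfl (arrowLeaf_ref_peak hB2 k)
    · -- readings of the hub: `q = M`, `c ∈ {0, 1}`
      have hqM : q = M := by omega
      by_cases hc0 : c = 0
      · have hne : (i : ℕ) ≠ 3 * M + 1 := by omega
        rw [if_neg hne, add_zero, hc0, add_zero, hqM] at hτi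
        have hpar : (-1 : ℝ) ^ (i : ℕ) = (-1) ^ M := by
          rw [hqc, hc0, hqM, show 3 * M + 0 = 2 * M + M by ring, pow_add, pow_mul]; norm_num
        rw [hpar, hτi]
        exact arrowSign_post M hB8 hMB
      · have hc1 : c = 1 := by omega
        have heq : (i : ℕ) = 3 * M + 1 := by omega
        rw [if_pos heq, hc1, hqM, show 8 * M + 6 + 1 + 1 = 8 * M + 8 by ring] at hτi
        have hpar : (-1 : ℝ) ^ (i : ℕ) = (-1) ^ (M + 1) := by
          rw [heq, show 3 * M + 1 = 2 * M + (M + 1) by ring, pow_add, pow_mul]; norm_num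
        rw [hpar, hτi]
        exact arrowSign_last M hB8 hMB
  -- the leaf-diagonal product has a constant sign on `t ≥ 0`
  have hPP : ∀ s t : ℝ, 0 ≤ s → 0 ≤ t →
      0 < (∏ k : Fin M, ((-1 : ℝ) ^ ((k : ℕ) + 1) + (-1 : ℝ) ^ ((k : ℕ) + 1) / B ^ (24 * ((k : ℕ) + 1)) * s ^ 3)) *
        (∏ k : Fin M, ((-1 : ℝ) ^ ((k : ℕ) + 1) + (-1 : ℝ) ^ ((k : ℕ) + 1) / B ^ (24 * ((k : ℕ) + 1)) * t ^ 3)) := by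
    intro s t hs ht
    rw [← Finset.prod_mul_distrib]
    refine Finset.prod_pos fun k _ => ?_
    have hsq : ((-1 : ℝ) ^ ((k : ℕ) + 1)) ^ 2 = 1 := by
      rw [← pow_mul, show ((k : ℕ) + 1) * 2 = 2 * ((k : ℕ) + 1) by ring, pow_mul]; norm_num
    have : ((-1 : ℝ) ^ ((k : ℕ) + 1) + (-1 : ℝ) ^ ((k : ℕ) + 1) / B ^ (24 * ((k : ℕ) + 1)) * s ^ 3) *
        ((-1 : ℝ) ^ ((k : ℕ) + 1) + (-1 : ℝ) ^ ((k : ℕ) + 1) / B ^ (24 * ((k : ℕ) + 1)) * t ^ 3)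
        = ((-1 : ℝ) ^ ((k : ℕ) + 1)) ^ 2 * ((1 + s ^ 3 / B ^ (24 * ((k : ℕ) + 1))) * (1 + t ^ 3 / B ^ (24 * ((k : ℕ) + 1)))) := by
      ring
    rw [this, hsq, one_mul]
    positivity
  -- conclude with the certificate
  refine fullyRealisable_of_certificate _ S (arrowPencil_isSymm M B) p heval hdeg τ hτmono hτpos fun i => ?_
  rw [hdet _ (hτpos _).le, hdet _ (hτpos _).le]
  have h1 := hsign i.castSucc
  have h2 := hsign i.succ
  simp only [Fin.val_castSucc] at h1
  simp only [Fin.val_succ] at h2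
  rw [pow_succ] at h2
  set s : ℝ := (-1 : ℝ) ^ (i : ℕ) with hs
  have hss : s * s = 1 := by rw [hs, ← pow_add, ← two_mul, pow_mul]; norm_num
  set P1 := ∏ k : Fin M, ((-1 : ℝ) ^ ((k : ℕ) + 1) + (-1 : ℝ) ^ ((k : ℕ) + 1) / B ^ (24 * ((k : ℕ) + 1)) * τ i.castSucc ^ 3) with hP1
  set P2 := ∏ k : Fin M, ((-1 : ℝ) ^ ((k : ℕ) + 1) + (-1 : ℝ) ^ ((k : ℕ) + 1) / B ^ (24 * ((k : ℕ) + 1)) * τ i.succ ^ 3) with hP2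
  set H1 := cor[B, M](τ i.castSucc) - ∑ j : Fin M, (-1 : ℝ) ^ ((j : ℕ) + 1) * G[B, j](τ i.castSucc) with hH1
  set H2 := cor[B, M](τ i.succ) - ∑ j : Fin M, (-1 : ℝ) ^ ((j : ℕ) + 1) * G[B, j](τ i.succ) with hH2
  have h12 := mul_pos h1 h2
  have hre : s * H1 * (s * -1 * H2) = -(s * s) * (H1 * H2) := by ring
  rw [hre, hss] at h12
  have hneg : H1 * H2 < 0 := by linarith
  have hpos := hPP _ _ (hτpos i.castSucc).le (hτpos i.succ).le
  calc P1 * H1 * (P2 * H2) = (P1 * P2) * (H1 * H2) := by ring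
    _ < 0 := mul_neg_of_pos_of_neg hpos hneg

/-- **THE `(0,1,3)` LADDER IS REALISABLE AT EVERY RUNG: `FullyRealisable m ![0,1,3] (3m − 2)` for all `m ≥ 1`** —
a real symmetric `m × m` half-pencil `S₀ + t S₁ + t³ S₂` whose determinant has degree exactly `3m − 2 = d(m+3−d) − 2`
(`d = 3`, the ceiling of the support) and `3m − 2` distinct positive zeros.  `m = 3, 4`: the column's top values
`7, 10` (`…FiniteSectorRealisable`, other witnesses); `m ≥ 5`: below the top rung, new. [folklore] -/
theorem fullyRealisable_ladder013 (m : ℕ) (hm : 1 ≤ m) : FullyRealisable m (![0, 1, 3] : Fin 3 → ℕ) (3 * m - 2) := by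
  obtain ⟨M, rfl⟩ : ∃ M, m = M + 1 := ⟨m - 1, by omega⟩
  rw [show 3 * (M + 1) - 2 = 3 * M + 1 by omega]
  exact fullyRealisable_ladder013_succ M

/-! ## §6 Stamp-table readings: `ν(m,3) ≥ 3m − 2` and `η(m,3) ≥ 6m − 4` for every `m` -/

/-- **`ν(m,3) ≥ 3m − 2` for every `m ≥ 1`** (kernel, all sizes): the stamp row `StampLawAt m 3 (3m − 3)` fails —
witness the `(0,1,3)` ladder.  Supersedes the all-`m` bound `ν(m,3) ≥ 2m` of the rank-one rung
(`not_stampLawAt_rankOneRung`) for `m ≥ 2`; the ceiling is `n(m,2) = ⌊(m²+6m+1)/4⌋` (`stampLawAt_K_three`). [folklore] -/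
theorem not_stampLawAt_ladder013 (m : ℕ) (hm : 1 ≤ m) : ¬ StampLawAt m 3 (3 * m - 3) := by
  intro h
  obtain ⟨S, hS, hfull, hdeg⟩ := fullyRealisable_ladder013 m hm
  have := h _ S hS hfull
  omega

/-- **`η(m,3) ≥ 6m − 4` for every `m ≥ 1`**: `¬ HypRootLawAt m 3 (6m − 5)` — the ladder doubled
(`not_hypRootLawAt_of_fullyRealisable`, T2 of line «finite»). [folklore] -/
theorem not_hypRootLawAt_ladder013 (m : ℕ) (hm : 1 ≤ m) : ¬ HypRootLawAt m 3 (6 * m - 5) :=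
  not_hypRootLawAt_of_fullyRealisable (fullyRealisable_ladder013 m hm) (by omega)


end Summit.ValiantsHypothesis.ValiantsHypothesis.Theorems.LacunarySymmetroidMatrixDescartes.FiniteSector
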